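import Mathlib
import Summits.ResolutionOfSingularities.ResolutionOfSingularities.Theorems.RadicialJungCleanModelsCleanProp44PhaseTwoNCP
import HarnessLib

/-!
# Route `RadicialJung`, crux `CleanModels` (stmt-ResolutionOfSingularities-15917), line `Sketch` rev 35, stub 6 `stub_cleanProp44` (X44c):
# TWELFTH CUT — clean Phase II reduced to its `Λ`-MINIMAL stages; (R1) ⟸ (R1ᵐⁱⁿ) ⟸ (R1ⁿᶜᵖ)

Seat decomp-res-hand-2 g17 (structural hand: «reduce to the most general landed lemma, then specialise»), sequel of the eleventh cut
✓ `cleanProp44_of_phaseTwoNCP_of_curveTauOneVN : (R1ⁿᶜᵖ) → (R3ᵛⁿ′) → X44c` (`…CleanProp44PhaseTwoNCP.lean`).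

The eleventh cut ran the printed loop of [CoP1] Prop. 4.4 (p. 10, step 3) on every meeting curve of `Σ` that is clean-permissible everywhere.  Its
engine does not care HOW the printed potential `Λ = Σ_{η} λ(𝒪_{X,η}/J_η)` (over the generic points `η` of the curves of `Σ = {ord ≥ μ}`) is made to
drop: this file states the loop in its MOST GENERAL form — strong induction on `Λ` over the stages without bad points reachable by clean-permissible
sequences — so that the research content of (R1) (clean Phase II of reach-tidy) is, BY A KERNEL THEOREM, confined to

  (R1ᵐⁱⁿ) «no-bad stages of a clean threefold at which two curves of `Σ` meet and which are `Λ`-MINIMAL: no clean-permissible sequence for `(J, μ)`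
  and the line of `G` reaches a stage without bad points of smaller `Λ`».

At a (R1ᵐⁱⁿ) stage every curve of `Σ` meeting another one has a point at which the line is not clean-permissible for it (else its blowing up is a
clean step reaching a no-bad stage of smaller `Λ`, ✓ `curveStep_noBad` / ✓ `curveStep_potential_lt`), so (R1ᵐⁱⁿ) ⟸ (R1ⁿᶜᵖ) and the eleventh cut
factors through the twelfth; but a (R1ᵐⁱⁿ) stage knows more: insertions (✓ `exists_isCleanPermissibleSeq_blowup_curve_of_base`) followed by the
blowing up of the strict transform, point blowing-ups at crossings, or ANY clean-permissible detour, never lower `Λ` while keeping the curves of `Σ`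
regular and transverse.

* `exists_isCleanPermissibleSeq_tidy_of_noBad_of_minimal` — (R1) at one stage from the schema (R1ᵐⁱⁿ) at the same prime.
* `phaseTwo_of_phaseTwoMin` — **(R1) ⟸ (R1ᵐⁱⁿ)** (binders of `hphaseTwo` of the tenth cut VERBATIM, hypotheses `(meet)`, `(min)` inserted).
* (companion file `…CleanProp44PhaseTwoMinOfNCP.lean`: `phaseTwoMin_of_phaseTwoNCP` — **(R1ᵐⁱⁿ) ⟸ (R1ⁿᶜᵖ)**, a `Λ`-minimal stage is an
  insertion-forced stage, so the eleventh cut factors through the twelfth.)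
* `cleanProp44_of_phaseTwoMin_of_curveTauOneVN` — **TWELFTH CUT: X44c (`stub_cleanProp44`, verbatim) ⟸ (R1ᵐⁱⁿ) ∧ (R3ᵛⁿ′)**.

NET for the planner (repair census of stub 6, by name): X44c ⟸ (R1ᵐⁱⁿ) clean Phase II at the `Λ`-minimal no-bad stages with a crossing [L–XL: the near
lines born by forced insertions, [CoP1] Lemma 4.3 (5)] ∧ (R3ᵛⁿ′) [XL].  RE-LINE proposal: `stub_cleanProp44 :=
cleanProp44_of_phaseTwoMin_of_curveTauOneVN stub_cleanPhaseTwoMin stub_cleanCurveTauOneVN`.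

Honest framing: OURS; (R1ᵐⁱⁿ) and (R3ᵛⁿ′) are NOT proved here; nothing here proves X44c, any case of `CleanModels`, or resolution of
singularities in characteristic `p`. [cite: CossartPiltant2008, Prop. 4.4 (proof, p. 10, step 3); Lemma 4.3 (2) (4)] [cite: Piltant2013, §2 Axiom 4]
-/

noncomputable section

set_option linter.dupNamespace false -- mandated namespace of this single-conjunct summit

open CategoryTheory CategoryTheory.Limits AlgebraicGeometry TopologicalSpace IsLocalRing
open Literature.AlgebraicGeometry.Resolution Literature.AlgebraicGeometry.Motives
open Scheme.IdealSheafData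
open Summit.ResolutionOfSingularities.ResolutionOfSingularities.Theorems.CP2008Prop44

namespace Summit.ResolutionOfSingularities.ResolutionOfSingularities.Theorems.RadicialJung.CleanModels

/-! ## §1 Clean Phase II from its `Λ`-minimal residual, at one stage -/

set_option maxHeartbeats 1600000 in
-- long binder lists and a three-way case analysis at every reachable stage
/-- **Clean Phase II of reach-tidy from the residual (R1ᵐⁱⁿ).**  `X` integral Noetherian regular quasi-excellent of dimension `≤ 3` with function
field of characteristic `p`, the line of `G` clean-regular at every point, `(J, μ)` with `μ ≥ 1`, `ord ≤ μ`, `V(J)` of codimension `≥ 2`, NO BAD POINT.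
Suppose (R1ᵐⁱⁿ) at the prime `p`: every such stage at which moreover two curves of `Σ` meet and from which no clean-permissible sequence reaches
a stage without bad points of smaller `Λ`, reaches a tidy stage by a clean-permissible sequence.  Then `X` reaches a tidy stage by a
clean-permissible sequence (strong induction on `Λ` over the reachable stages without bad points; composition ✓ `IsCleanPermissibleSeq.comp`,
cleanness upstairs ✓ `IsCleanPermissibleSeq.cleanRegAt`). [cite: CossartPiltant2008, Prop. 4.4 (proof, p. 10, step 3)] [cite: Piltant2013, §2 Axiom 4] -/
theorem exists_isCleanPermissibleSeq_tidy_of_noBad_of_minimal {p : ℕ} (hp : p.Prime) {X : Scheme.{0}} [IsIntegral X] [IsNoetherian X]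
    [hcharX : CharP X.functionField p] (hX : Scheme.IsRegular X) (hqe : Scheme.IsQuasiExcellent X) (hX3 : topologicalKrullDim X ≤ 3)
    (G : X.functionField) (hG : ∀ x : X, CleanRegAt p (algebraMap (X.presheaf.stalk x) X.functionField) G)
    (J : X.IdealSheafData) {μ : ℕ} (hμ : 1 ≤ μ) (hle : ∀ z, idealOrder J z ≤ μ) (hcodim : ∀ z ∈ J.support, 1 < Order.coheight z)
    (hRT : ∀ x : X, ¬ ∃ C ∈ {C : Closeds X | ∃ ζ ∈ maxPoints {z : X | (μ : ℕ∞) ≤ idealOrder J z},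
        ¬ IsClosed ({ζ} : Set X) ∧ C = ⟨closure {ζ}, isClosed_closure⟩},
      x ∈ (vanishingIdeal C).subschemeι '' (Scheme.regularLocus (vanishingIdeal C).subscheme)ᶜ ∨
      (x ∈ (C : Set X) ∧ ∃ C' ∈ {C : Closeds X | ∃ ζ ∈ maxPoints {z : X | (μ : ℕ∞) ≤ idealOrder J z},
          ¬ IsClosed ({ζ} : Set X) ∧ C = ⟨closure {ζ}, isClosed_closure⟩}, C' ≠ C ∧ x ∈ (C' : Set X) ∧
        stalkIdeal (vanishingIdeal C) x ⊔ stalkIdeal (vanishingIdeal C') x ≠ maximalIdeal (X.presheaf.stalk x)))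
    (hMIN : ∀ {X : Scheme.{0}} [IsIntegral X] [IsNoetherian X], CharP X.functionField p →
      ∀ (hX : Scheme.IsRegular X), Scheme.IsQuasiExcellent X → topologicalKrullDim X ≤ 3 →
      ∀ (G : X.functionField), (∀ x : X, CleanRegAt p (algebraMap (X.presheaf.stalk x) X.functionField) G) →
      ∀ (J : X.IdealSheafData), (∀ z, idealOrder J z ≤ μ) → (∀ z ∈ J.support, 1 < Order.coheight z) →
      (∀ x : X, ¬ ∃ C ∈ {C : Closeds X | ∃ ζ ∈ maxPoints {z : X | (μ : ℕ∞) ≤ idealOrder J z},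
          ¬ IsClosed ({ζ} : Set X) ∧ C = ⟨closure {ζ}, isClosed_closure⟩},
        x ∈ (vanishingIdeal C).subschemeι '' (Scheme.regularLocus (vanishingIdeal C).subscheme)ᶜ ∨
        (x ∈ (C : Set X) ∧ ∃ C' ∈ {C : Closeds X | ∃ ζ ∈ maxPoints {z : X | (μ : ℕ∞) ≤ idealOrder J z},
            ¬ IsClosed ({ζ} : Set X) ∧ C = ⟨closure {ζ}, isClosed_closure⟩}, C' ≠ C ∧ x ∈ (C' : Set X) ∧
          stalkIdeal (vanishingIdeal C) x ⊔ stalkIdeal (vanishingIdeal C') x ≠ maximalIdeal (X.presheaf.stalk x))) →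
      -- (meet) two distinct curves of `Σ` meet
      (∃ ζ₁ ζ₂ : X, (μ : ℕ∞) ≤ idealOrder J ζ₁ ∧ Order.coheight ζ₁ = 2 ∧ ¬ IsClosed ({ζ₁} : Set X) ∧
          (μ : ℕ∞) ≤ idealOrder J ζ₂ ∧ Order.coheight ζ₂ = 2 ∧ ¬ IsClosed ({ζ₂} : Set X) ∧ ζ₁ ≠ ζ₂ ∧
          ¬ Disjoint (closure ({ζ₁} : Set X)) (closure {ζ₂})) →
      -- (min) `Λ` does not drop along any clean-permissible sequence reaching a stage without bad points
      (∀ (X₁ : Scheme.{0}) [IsIntegral X₁] (Φ : X₁ ⟶ X) [IsDominant Φ] (J₁ : X₁.IdealSheafData),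
        IsCleanPermissibleSeq p Φ J μ J₁ G →
        (∀ x : X₁, ¬ ∃ C ∈ {C : Closeds X₁ | ∃ ζ ∈ maxPoints {z : X₁ | (μ : ℕ∞) ≤ idealOrder J₁ z},
            ¬ IsClosed ({ζ} : Set X₁) ∧ C = ⟨closure {ζ}, isClosed_closure⟩},
          x ∈ (vanishingIdeal C).subschemeι '' (Scheme.regularLocus (vanishingIdeal C).subscheme)ᶜ ∨
          (x ∈ (C : Set X₁) ∧ ∃ C' ∈ {C : Closeds X₁ | ∃ ζ ∈ maxPoints {z : X₁ | (μ : ℕ∞) ≤ idealOrder J₁ z},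
              ¬ IsClosed ({ζ} : Set X₁) ∧ C = ⟨closure {ζ}, isClosed_closure⟩}, C' ≠ C ∧ x ∈ (C' : Set X₁) ∧
            stalkIdeal (vanishingIdeal C) x ⊔ stalkIdeal (vanishingIdeal C') x ≠ maximalIdeal (X₁.presheaf.stalk x))) →
        (∑ᶠ ζ ∈ {ζ : X | ζ ∈ maxPoints {z : X | (μ : ℕ∞) ≤ idealOrder J z} ∧ ¬ IsClosed ({ζ} : Set X)},
            (Module.length (X.presheaf.stalk ζ) (X.presheaf.stalk ζ ⧸ stalkIdeal J ζ)).toNat) ≤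
          (∑ᶠ ζ ∈ {ζ : X₁ | ζ ∈ maxPoints {z : X₁ | (μ : ℕ∞) ≤ idealOrder J₁ z} ∧ ¬ IsClosed ({ζ} : Set X₁)},
              (Module.length (X₁.presheaf.stalk ζ) (X₁.presheaf.stalk ζ ⧸ stalkIdeal J₁ ζ)).toNat)) →
      ∃ (X₁ : Scheme.{0}) (Φ : X₁ ⟶ X) (_ : IsIntegral X₁) (_ : IsDominant Φ) (J₁ : X₁.IdealSheafData)
        (_ : IsCleanPermissibleSeq p Φ J μ J₁ G),
        (∀ ζ : X₁, (μ : ℕ∞) ≤ idealOrder J₁ ζ → Order.coheight ζ = 2 → ¬ IsClosed ({ζ} : Set X₁) →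
            Scheme.IsRegular (vanishingIdeal (⟨closure {ζ}, isClosed_closure⟩ : Closeds X₁)).subscheme) ∧
        (∀ ζ₁ ζ₂ : X₁, (μ : ℕ∞) ≤ idealOrder J₁ ζ₁ → Order.coheight ζ₁ = 2 → ¬ IsClosed ({ζ₁} : Set X₁) →
            (μ : ℕ∞) ≤ idealOrder J₁ ζ₂ → Order.coheight ζ₂ = 2 → ¬ IsClosed ({ζ₂} : Set X₁) → ζ₁ ≠ ζ₂ →
            Disjoint (closure ({ζ₁} : Set X₁)) (closure {ζ₂}))) :
    ∃ (X₁ : Scheme.{0}) (Φ : X₁ ⟶ X) (_ : IsIntegral X₁) (_ : IsDominant Φ) (J₁ : X₁.IdealSheafData)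
      (_ : IsCleanPermissibleSeq p Φ J μ J₁ G),
      (∀ ζ : X₁, (μ : ℕ∞) ≤ idealOrder J₁ ζ → Order.coheight ζ = 2 → ¬ IsClosed ({ζ} : Set X₁) →
          Scheme.IsRegular (vanishingIdeal (⟨closure {ζ}, isClosed_closure⟩ : Closeds X₁)).subscheme) ∧
      (∀ ζ₁ ζ₂ : X₁, (μ : ℕ∞) ≤ idealOrder J₁ ζ₁ → Order.coheight ζ₁ = 2 → ¬ IsClosed ({ζ₁} : Set X₁) →
          (μ : ℕ∞) ≤ idealOrder J₁ ζ₂ → Order.coheight ζ₂ = 2 → ¬ IsClosed ({ζ₂} : Set X₁) → ζ₁ ≠ ζ₂ →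
          Disjoint (closure ({ζ₁} : Set X₁)) (closure {ζ₂})) := by
  classical
  -- the invariants at every reachable stage (over the forgetful map to the W4.6 currency)
  have inv := fun {X₁ : Scheme.{0}} [IsIntegral X₁] {Φ : X₁ ⟶ X} [IsDominant Φ] {J₁ : X₁.IdealSheafData}
      (h : IsCleanPermissibleSeq p Φ J μ J₁ G) =>
    IsPermissibleBlowupSeq.prop44Invariants hX hqe hμ hle hcodim (isPermissibleBlowupSeq_of_isPermissibleSeq h.isPermissibleSeq)
  -- ONE STEP at a reachable stage without bad points: the answer, or a reachable stage without bad points and with smaller `Λ`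
  have step : ∀ (X₁ : Scheme.{0}) [IsIntegral X₁] (Φ : X₁ ⟶ X) [IsDominant Φ] (J₁ : X₁.IdealSheafData),
      IsCleanPermissibleSeq p Φ J μ J₁ G →
      (∀ x : X₁, ¬ ∃ C ∈ {C : Closeds X₁ | ∃ ζ ∈ maxPoints {z : X₁ | (μ : ℕ∞) ≤ idealOrder J₁ z},
          ¬ IsClosed ({ζ} : Set X₁) ∧ C = ⟨closure {ζ}, isClosed_closure⟩},
        x ∈ (vanishingIdeal C).subschemeι '' (Scheme.regularLocus (vanishingIdeal C).subscheme)ᶜ ∨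
        (x ∈ (C : Set X₁) ∧ ∃ C' ∈ {C : Closeds X₁ | ∃ ζ ∈ maxPoints {z : X₁ | (μ : ℕ∞) ≤ idealOrder J₁ z},
            ¬ IsClosed ({ζ} : Set X₁) ∧ C = ⟨closure {ζ}, isClosed_closure⟩}, C' ≠ C ∧ x ∈ (C' : Set X₁) ∧
          stalkIdeal (vanishingIdeal C) x ⊔ stalkIdeal (vanishingIdeal C') x ≠ maximalIdeal (X₁.presheaf.stalk x))) →
      (∃ (X₂ : Scheme.{0}) (Ψ : X₂ ⟶ X) (_ : IsIntegral X₂) (_ : IsDominant Ψ) (J₂ : X₂.IdealSheafData)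
          (_ : IsCleanPermissibleSeq p Ψ J μ J₂ G),
          (∀ ζ : X₂, (μ : ℕ∞) ≤ idealOrder J₂ ζ → Order.coheight ζ = 2 → ¬ IsClosed ({ζ} : Set X₂) →
              Scheme.IsRegular (vanishingIdeal (⟨closure {ζ}, isClosed_closure⟩ : Closeds X₂)).subscheme) ∧
          (∀ ζ₁ ζ₂ : X₂, (μ : ℕ∞) ≤ idealOrder J₂ ζ₁ → Order.coheight ζ₁ = 2 → ¬ IsClosed ({ζ₁} : Set X₂) →
              (μ : ℕ∞) ≤ idealOrder J₂ ζ₂ → Order.coheight ζ₂ = 2 → ¬ IsClosed ({ζ₂} : Set X₂) → ζ₁ ≠ ζ₂ →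
              Disjoint (closure ({ζ₁} : Set X₂)) (closure {ζ₂}))) ∨
      (∃ (X₂ : Scheme.{0}) (_ : IsIntegral X₂) (Φ₂ : X₂ ⟶ X) (_ : IsDominant Φ₂) (J₂ : X₂.IdealSheafData),
          IsCleanPermissibleSeq p Φ₂ J μ J₂ G ∧
          (∀ x : X₂, ¬ ∃ C ∈ {C : Closeds X₂ | ∃ ζ ∈ maxPoints {z : X₂ | (μ : ℕ∞) ≤ idealOrder J₂ z},
              ¬ IsClosed ({ζ} : Set X₂) ∧ C = ⟨closure {ζ}, isClosed_closure⟩},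
            x ∈ (vanishingIdeal C).subschemeι '' (Scheme.regularLocus (vanishingIdeal C).subscheme)ᶜ ∨
            (x ∈ (C : Set X₂) ∧ ∃ C' ∈ {C : Closeds X₂ | ∃ ζ ∈ maxPoints {z : X₂ | (μ : ℕ∞) ≤ idealOrder J₂ z},
                ¬ IsClosed ({ζ} : Set X₂) ∧ C = ⟨closure {ζ}, isClosed_closure⟩}, C' ≠ C ∧ x ∈ (C' : Set X₂) ∧
              stalkIdeal (vanishingIdeal C) x ⊔ stalkIdeal (vanishingIdeal C') x ≠ maximalIdeal (X₂.presheaf.stalk x))) ∧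
          (∑ᶠ ζ ∈ {ζ : X₂ | ζ ∈ maxPoints {z : X₂ | (μ : ℕ∞) ≤ idealOrder J₂ z} ∧ ¬ IsClosed ({ζ} : Set X₂)},
              (Module.length (X₂.presheaf.stalk ζ) (X₂.presheaf.stalk ζ ⧸ stalkIdeal J₂ ζ)).toNat) <
            ∑ᶠ ζ ∈ {ζ : X₁ | ζ ∈ maxPoints {z : X₁ | (μ : ℕ∞) ≤ idealOrder J₁ z} ∧ ¬ IsClosed ({ζ} : Set X₁)},
              (Module.length (X₁.presheaf.stalk ζ) (X₁.presheaf.stalk ζ ⧸ stalkIdeal J₁ ζ)).toNat) := by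
    intro X₁ _ Φ _ J₁ hseq hI
    obtain ⟨-, hnoeth₁, hX₁, hqe₁, hle₁, hcodim₁⟩ := inv hseq
    haveI := hnoeth₁
    have hX3₁ : topologicalKrullDim X₁ ≤ 3 :=
      (isPermissibleBlowupSeq_of_isPermissibleSeq hseq.isPermissibleSeq).topologicalKrullDim_le inferInstance hX3
    have hcoh3 : ∀ z : X₁, Order.coheight z ≤ 3 := (topologicalKrullDim_le_iff_forall_coheight_le X₁ 3).mp hX3₁
    haveI hcharX₁ : CharP X₁.functionField p := charP_of_injective_ringHom (RatFn.functionFieldMap Φ).injective p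
    -- the line stays clean-regular at every point of the stage
    have hG₁ : ∀ x : X₁, CleanRegAt p (algebraMap (X₁.presheaf.stalk x) X₁.functionField) (RatFn.functionFieldMap Φ G) :=
      hseq.cleanRegAt hp hcharX hG
    -- the curves of `Σ` are regular (no bad point)
    have hREG : ∀ ζ : X₁, (μ : ℕ∞) ≤ idealOrder J₁ ζ → Order.coheight ζ = 2 → ¬ IsClosed ({ζ} : Set X₁) →
        Scheme.IsRegular (vanishingIdeal (⟨closure {ζ}, isClosed_closure⟩ : Closeds X₁)).subscheme :=
      fun ζ hζ hcoh hcl => (curve_of_noBad hX₁ hX3₁ J₁ hμ hle₁ hcodim₁ (𝒞 := {C : Closeds X₁ | _}) (fun C => Iff.rfl) hI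
        ⟨ζ, mem_maxPoints_setOf_of_coheight_eq_two hμ hcoh3 hcodim₁ hζ hcoh, hcl, rfl⟩).1
    by_cases hmeet : ∃ ζ₁ ζ₂ : X₁, (μ : ℕ∞) ≤ idealOrder J₁ ζ₁ ∧ Order.coheight ζ₁ = 2 ∧ ¬ IsClosed ({ζ₁} : Set X₁) ∧
        (μ : ℕ∞) ≤ idealOrder J₁ ζ₂ ∧ Order.coheight ζ₂ = 2 ∧ ¬ IsClosed ({ζ₂} : Set X₁) ∧ ζ₁ ≠ ζ₂ ∧
        ¬ Disjoint (closure ({ζ₁} : Set X₁)) (closure {ζ₂})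
    · by_cases hdrop : ∃ (X₂ : Scheme.{0}) (_ : IsIntegral X₂) (Φ₂ : X₂ ⟶ X₁) (_ : IsDominant Φ₂) (J₂ : X₂.IdealSheafData),
          IsCleanPermissibleSeq p Φ₂ J₁ μ J₂ (RatFn.functionFieldMap Φ G) ∧
          (∀ x : X₂, ¬ ∃ C ∈ {C : Closeds X₂ | ∃ ζ ∈ maxPoints {z : X₂ | (μ : ℕ∞) ≤ idealOrder J₂ z},
              ¬ IsClosed ({ζ} : Set X₂) ∧ C = ⟨closure {ζ}, isClosed_closure⟩},
            x ∈ (vanishingIdeal C).subschemeι '' (Scheme.regularLocus (vanishingIdeal C).subscheme)ᶜ ∨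
            (x ∈ (C : Set X₂) ∧ ∃ C' ∈ {C : Closeds X₂ | ∃ ζ ∈ maxPoints {z : X₂ | (μ : ℕ∞) ≤ idealOrder J₂ z},
                ¬ IsClosed ({ζ} : Set X₂) ∧ C = ⟨closure {ζ}, isClosed_closure⟩}, C' ≠ C ∧ x ∈ (C' : Set X₂) ∧
              stalkIdeal (vanishingIdeal C) x ⊔ stalkIdeal (vanishingIdeal C') x ≠ maximalIdeal (X₂.presheaf.stalk x))) ∧
          (∑ᶠ ζ ∈ {ζ : X₂ | ζ ∈ maxPoints {z : X₂ | (μ : ℕ∞) ≤ idealOrder J₂ z} ∧ ¬ IsClosed ({ζ} : Set X₂)},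
              (Module.length (X₂.presheaf.stalk ζ) (X₂.presheaf.stalk ζ ⧸ stalkIdeal J₂ ζ)).toNat) <
            (∑ᶠ ζ ∈ {ζ : X₁ | ζ ∈ maxPoints {z : X₁ | (μ : ℕ∞) ≤ idealOrder J₁ z} ∧ ¬ IsClosed ({ζ} : Set X₁)},
                (Module.length (X₁.presheaf.stalk ζ) (X₁.presheaf.stalk ζ ⧸ stalkIdeal J₁ ζ)).toNat)
      · -- a clean-permissible detour to a no-bad stage of smaller `Λ`: compose and recurse
        obtain ⟨X₂, hX₂, Φ₂, hΦ₂, J₂, hseq₂, hI₂, hlt⟩ := hdrop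
        haveI := hX₂
        haveI := hΦ₂
        exact Or.inr ⟨X₂, inferInstance, Φ₂ ≫ Φ, inferInstance, J₂, hseq.comp hseq₂ rfl, hI₂, hlt⟩
      · -- a (R1ᵐⁱⁿ) stage: the hypothesis, applied to the transform of `G`, then composition
        have hmin : ∀ (X₂ : Scheme.{0}) [IsIntegral X₂] (Φ₂ : X₂ ⟶ X₁) [IsDominant Φ₂] (J₂ : X₂.IdealSheafData),
            IsCleanPermissibleSeq p Φ₂ J₁ μ J₂ (RatFn.functionFieldMap Φ G) →
            (∀ x : X₂, ¬ ∃ C ∈ {C : Closeds X₂ | ∃ ζ ∈ maxPoints {z : X₂ | (μ : ℕ∞) ≤ idealOrder J₂ z},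
                ¬ IsClosed ({ζ} : Set X₂) ∧ C = ⟨closure {ζ}, isClosed_closure⟩},
              x ∈ (vanishingIdeal C).subschemeι '' (Scheme.regularLocus (vanishingIdeal C).subscheme)ᶜ ∨
              (x ∈ (C : Set X₂) ∧ ∃ C' ∈ {C : Closeds X₂ | ∃ ζ ∈ maxPoints {z : X₂ | (μ : ℕ∞) ≤ idealOrder J₂ z},
                  ¬ IsClosed ({ζ} : Set X₂) ∧ C = ⟨closure {ζ}, isClosed_closure⟩}, C' ≠ C ∧ x ∈ (C' : Set X₂) ∧
                stalkIdeal (vanishingIdeal C) x ⊔ stalkIdeal (vanishingIdeal C') x ≠ maximalIdeal (X₂.presheaf.stalk x))) →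
            (∑ᶠ ζ ∈ {ζ : X₁ | ζ ∈ maxPoints {z : X₁ | (μ : ℕ∞) ≤ idealOrder J₁ z} ∧ ¬ IsClosed ({ζ} : Set X₁)},
                (Module.length (X₁.presheaf.stalk ζ) (X₁.presheaf.stalk ζ ⧸ stalkIdeal J₁ ζ)).toNat) ≤
              (∑ᶠ ζ ∈ {ζ : X₂ | ζ ∈ maxPoints {z : X₂ | (μ : ℕ∞) ≤ idealOrder J₂ z} ∧ ¬ IsClosed ({ζ} : Set X₂)},
                  (Module.length (X₂.presheaf.stalk ζ) (X₂.presheaf.stalk ζ ⧸ stalkIdeal J₂ ζ)).toNat) := by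
          intro X₂ _ Φ₂ _ J₂ hseq₂ hI₂
          by_contra hlt
          exact hdrop ⟨X₂, inferInstance, Φ₂, inferInstance, J₂, hseq₂, hI₂, lt_of_not_ge hlt⟩
        have hres := hMIN hcharX₁ hX₁ hqe₁ hX3₁ (RatFn.functionFieldMap Φ G) hG₁ J₁ hle₁ hcodim₁ hI hmeet hmin
        obtain ⟨X₂, Ψ, hX₂, hΨ, J₂, hseq', htidy⟩ := hres
        haveI := hX₂
        haveI := hΨ
        exact Or.inl ⟨X₂, Ψ ≫ Φ, inferInstance, inferInstance, J₂, hseq.comp hseq' rfl, htidy⟩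
    · -- the stage is already TIDY
      refine Or.inl ⟨X₁, Φ, inferInstance, inferInstance, J₁, hseq, hREG, ?_⟩
      intro ζ₁ ζ₂ h1 h2 h3 h4 h5 h6 hne
      by_contra hd
      exact hmeet ⟨ζ₁, ζ₂, h1, h2, h3, h4, h5, h6, hne, hd⟩
  have key : ∀ (n : ℕ) (X₁ : Scheme.{0}) [IsIntegral X₁] (Φ : X₁ ⟶ X) [IsDominant Φ] (J₁ : X₁.IdealSheafData),
      IsCleanPermissibleSeq p Φ J μ J₁ G →
      (∀ x : X₁, ¬ ∃ C ∈ {C : Closeds X₁ | ∃ ζ ∈ maxPoints {z : X₁ | (μ : ℕ∞) ≤ idealOrder J₁ z},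
          ¬ IsClosed ({ζ} : Set X₁) ∧ C = ⟨closure {ζ}, isClosed_closure⟩},
        x ∈ (vanishingIdeal C).subschemeι '' (Scheme.regularLocus (vanishingIdeal C).subscheme)ᶜ ∨
        (x ∈ (C : Set X₁) ∧ ∃ C' ∈ {C : Closeds X₁ | ∃ ζ ∈ maxPoints {z : X₁ | (μ : ℕ∞) ≤ idealOrder J₁ z},
            ¬ IsClosed ({ζ} : Set X₁) ∧ C = ⟨closure {ζ}, isClosed_closure⟩}, C' ≠ C ∧ x ∈ (C' : Set X₁) ∧
          stalkIdeal (vanishingIdeal C) x ⊔ stalkIdeal (vanishingIdeal C') x ≠ maximalIdeal (X₁.presheaf.stalk x))) →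
      (∑ᶠ ζ ∈ {ζ : X₁ | ζ ∈ maxPoints {z : X₁ | (μ : ℕ∞) ≤ idealOrder J₁ z} ∧ ¬ IsClosed ({ζ} : Set X₁)},
          (Module.length (X₁.presheaf.stalk ζ) (X₁.presheaf.stalk ζ ⧸ stalkIdeal J₁ ζ)).toNat) ≤ n →
      ∃ (X₂ : Scheme.{0}) (Ψ : X₂ ⟶ X) (_ : IsIntegral X₂) (_ : IsDominant Ψ) (J₂ : X₂.IdealSheafData)
        (_ : IsCleanPermissibleSeq p Ψ J μ J₂ G),
        (∀ ζ : X₂, (μ : ℕ∞) ≤ idealOrder J₂ ζ → Order.coheight ζ = 2 → ¬ IsClosed ({ζ} : Set X₂) →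
            Scheme.IsRegular (vanishingIdeal (⟨closure {ζ}, isClosed_closure⟩ : Closeds X₂)).subscheme) ∧
        (∀ ζ₁ ζ₂ : X₂, (μ : ℕ∞) ≤ idealOrder J₂ ζ₁ → Order.coheight ζ₁ = 2 → ¬ IsClosed ({ζ₁} : Set X₂) →
            (μ : ℕ∞) ≤ idealOrder J₂ ζ₂ → Order.coheight ζ₂ = 2 → ¬ IsClosed ({ζ₂} : Set X₂) → ζ₁ ≠ ζ₂ →
            Disjoint (closure ({ζ₁} : Set X₂)) (closure {ζ₂})) := by
    intro n
    induction n with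
    | zero =>
      intro X₁ _ Φ _ J₁ hseq hI hΛ
      rcases step X₁ Φ J₁ hseq hI with hdone | ⟨X₂, hX₂, Φ₂, hΦ₂, J₂, -, -, hlt⟩
      · exact hdone
      · exfalso
        omega
    | succ n ih =>
      intro X₁ _ Φ _ J₁ hseq hI hΛ
      rcases step X₁ Φ J₁ hseq hI with hdone | ⟨X₂, hX₂, Φ₂, hΦ₂, J₂, hseq₂, hI₂, hlt⟩
      · exact hdone
      · haveI := hX₂
        haveI := hΦ₂
        exact ih X₂ Φ₂ J₂ hseq₂ hI₂ (by omega)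
  -- start of the induction: the empty sequence
  have h0 := key _ X (𝟙 X) J (IsCleanPermissibleSeq.nil J μ G) hRT le_rfl
  exact h0

/-! ## §2 (R1) ⟸ (R1ᵐⁱⁿ) as hypothesis schemas -/

set_option maxHeartbeats 800000 in
-- long binder lists
/-- **(R1) ⟸ (R1ᵐⁱⁿ)**: the hypothesis `hphaseTwo` of ✓ `cleanProp44_of_phaseTwo_of_curveTauOneVN` (clean Phase II of reach-tidy, VERBATIM) follows
from its restriction (R1ᵐⁱⁿ) to the stages at which two curves of `Σ` meet and which are `Λ`-minimal among the no-bad stages they reach by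
clean-permissible sequences (hypotheses `(meet)`, `(min)` inserted; everything else verbatim) — by `exists_isCleanPermissibleSeq_tidy_of_noBad_of_minimal`
at each prime. [cite: CossartPiltant2008, Prop. 4.4 (proof, p. 10, step 3)] [cite: Piltant2013, §2 Axiom 4] -/
theorem phaseTwo_of_phaseTwoMin
    (hphaseTwoMin : ∀ (p : ℕ), p.Prime → ∀ {X : Scheme.{0}} [IsIntegral X] [IsNoetherian X], CharP X.functionField p →
      ∀ (hX : Scheme.IsRegular X), Scheme.IsQuasiExcellent X → topologicalKrullDim X ≤ 3 →
      ∀ (G : X.functionField), (∀ x : X, CleanRegAt p (algebraMap (X.presheaf.stalk x) X.functionField) G) →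
      ∀ (J : X.IdealSheafData) {μ : ℕ}, 1 ≤ μ → (∀ z, idealOrder J z ≤ μ) → (∀ z ∈ J.support, 1 < Order.coheight z) →
      (∀ x : X, ¬ ∃ C ∈ {C : Closeds X | ∃ ζ ∈ maxPoints {z : X | (μ : ℕ∞) ≤ idealOrder J z},
          ¬ IsClosed ({ζ} : Set X) ∧ C = ⟨closure {ζ}, isClosed_closure⟩},
        x ∈ (vanishingIdeal C).subschemeι '' (Scheme.regularLocus (vanishingIdeal C).subscheme)ᶜ ∨
        (x ∈ (C : Set X) ∧ ∃ C' ∈ {C : Closeds X | ∃ ζ ∈ maxPoints {z : X | (μ : ℕ∞) ≤ idealOrder J z},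
            ¬ IsClosed ({ζ} : Set X) ∧ C = ⟨closure {ζ}, isClosed_closure⟩}, C' ≠ C ∧ x ∈ (C' : Set X) ∧
          stalkIdeal (vanishingIdeal C) x ⊔ stalkIdeal (vanishingIdeal C') x ≠ maximalIdeal (X.presheaf.stalk x))) →
      -- (meet) two distinct curves of `Σ` meet
      (∃ ζ₁ ζ₂ : X, (μ : ℕ∞) ≤ idealOrder J ζ₁ ∧ Order.coheight ζ₁ = 2 ∧ ¬ IsClosed ({ζ₁} : Set X) ∧
          (μ : ℕ∞) ≤ idealOrder J ζ₂ ∧ Order.coheight ζ₂ = 2 ∧ ¬ IsClosed ({ζ₂} : Set X) ∧ ζ₁ ≠ ζ₂ ∧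
          ¬ Disjoint (closure ({ζ₁} : Set X)) (closure {ζ₂})) →
      -- (min) `Λ` does not drop along any clean-permissible sequence reaching a stage without bad points
      (∀ (X₁ : Scheme.{0}) [IsIntegral X₁] (Φ : X₁ ⟶ X) [IsDominant Φ] (J₁ : X₁.IdealSheafData),
        IsCleanPermissibleSeq p Φ J μ J₁ G →
        (∀ x : X₁, ¬ ∃ C ∈ {C : Closeds X₁ | ∃ ζ ∈ maxPoints {z : X₁ | (μ : ℕ∞) ≤ idealOrder J₁ z},
            ¬ IsClosed ({ζ} : Set X₁) ∧ C = ⟨closure {ζ}, isClosed_closure⟩},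
          x ∈ (vanishingIdeal C).subschemeι '' (Scheme.regularLocus (vanishingIdeal C).subscheme)ᶜ ∨
          (x ∈ (C : Set X₁) ∧ ∃ C' ∈ {C : Closeds X₁ | ∃ ζ ∈ maxPoints {z : X₁ | (μ : ℕ∞) ≤ idealOrder J₁ z},
              ¬ IsClosed ({ζ} : Set X₁) ∧ C = ⟨closure {ζ}, isClosed_closure⟩}, C' ≠ C ∧ x ∈ (C' : Set X₁) ∧
            stalkIdeal (vanishingIdeal C) x ⊔ stalkIdeal (vanishingIdeal C') x ≠ maximalIdeal (X₁.presheaf.stalk x))) →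
        (∑ᶠ ζ ∈ {ζ : X | ζ ∈ maxPoints {z : X | (μ : ℕ∞) ≤ idealOrder J z} ∧ ¬ IsClosed ({ζ} : Set X)},
            (Module.length (X.presheaf.stalk ζ) (X.presheaf.stalk ζ ⧸ stalkIdeal J ζ)).toNat) ≤
          (∑ᶠ ζ ∈ {ζ : X₁ | ζ ∈ maxPoints {z : X₁ | (μ : ℕ∞) ≤ idealOrder J₁ z} ∧ ¬ IsClosed ({ζ} : Set X₁)},
              (Module.length (X₁.presheaf.stalk ζ) (X₁.presheaf.stalk ζ ⧸ stalkIdeal J₁ ζ)).toNat)) →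
      ∃ (X₁ : Scheme.{0}) (Φ : X₁ ⟶ X) (_ : IsIntegral X₁) (_ : IsDominant Φ) (J₁ : X₁.IdealSheafData)
        (_ : IsCleanPermissibleSeq p Φ J μ J₁ G),
        (∀ ζ : X₁, (μ : ℕ∞) ≤ idealOrder J₁ ζ → Order.coheight ζ = 2 → ¬ IsClosed ({ζ} : Set X₁) →
            Scheme.IsRegular (vanishingIdeal (⟨closure {ζ}, isClosed_closure⟩ : Closeds X₁)).subscheme) ∧
        (∀ ζ₁ ζ₂ : X₁, (μ : ℕ∞) ≤ idealOrder J₁ ζ₁ → Order.coheight ζ₁ = 2 → ¬ IsClosed ({ζ₁} : Set X₁) →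
            (μ : ℕ∞) ≤ idealOrder J₁ ζ₂ → Order.coheight ζ₂ = 2 → ¬ IsClosed ({ζ₂} : Set X₁) → ζ₁ ≠ ζ₂ →
            Disjoint (closure ({ζ₁} : Set X₁)) (closure {ζ₂}))) :
    ∀ (p : ℕ), p.Prime → ∀ {X : Scheme.{0}} [IsIntegral X] [IsNoetherian X], CharP X.functionField p →
      ∀ (hX : Scheme.IsRegular X), Scheme.IsQuasiExcellent X → topologicalKrullDim X ≤ 3 →
      ∀ (G : X.functionField), (∀ x : X, CleanRegAt p (algebraMap (X.presheaf.stalk x) X.functionField) G) →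
      ∀ (J : X.IdealSheafData) {μ : ℕ}, 1 ≤ μ → (∀ z, idealOrder J z ≤ μ) → (∀ z ∈ J.support, 1 < Order.coheight z) →
      (∀ x : X, ¬ ∃ C ∈ {C : Closeds X | ∃ ζ ∈ maxPoints {z : X | (μ : ℕ∞) ≤ idealOrder J z},
          ¬ IsClosed ({ζ} : Set X) ∧ C = ⟨closure {ζ}, isClosed_closure⟩},
        x ∈ (vanishingIdeal C).subschemeι '' (Scheme.regularLocus (vanishingIdeal C).subscheme)ᶜ ∨
        (x ∈ (C : Set X) ∧ ∃ C' ∈ {C : Closeds X | ∃ ζ ∈ maxPoints {z : X | (μ : ℕ∞) ≤ idealOrder J z},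
            ¬ IsClosed ({ζ} : Set X) ∧ C = ⟨closure {ζ}, isClosed_closure⟩}, C' ≠ C ∧ x ∈ (C' : Set X) ∧
          stalkIdeal (vanishingIdeal C) x ⊔ stalkIdeal (vanishingIdeal C') x ≠ maximalIdeal (X.presheaf.stalk x))) →
      ∃ (X₁ : Scheme.{0}) (Φ : X₁ ⟶ X) (_ : IsIntegral X₁) (_ : IsDominant Φ) (J₁ : X₁.IdealSheafData)
        (_ : IsCleanPermissibleSeq p Φ J μ J₁ G),
        (∀ ζ : X₁, (μ : ℕ∞) ≤ idealOrder J₁ ζ → Order.coheight ζ = 2 → ¬ IsClosed ({ζ} : Set X₁) →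
            Scheme.IsRegular (vanishingIdeal (⟨closure {ζ}, isClosed_closure⟩ : Closeds X₁)).subscheme) ∧
        (∀ ζ₁ ζ₂ : X₁, (μ : ℕ∞) ≤ idealOrder J₁ ζ₁ → Order.coheight ζ₁ = 2 → ¬ IsClosed ({ζ₁} : Set X₁) →
            (μ : ℕ∞) ≤ idealOrder J₁ ζ₂ → Order.coheight ζ₂ = 2 → ¬ IsClosed ({ζ₂} : Set X₁) → ζ₁ ≠ ζ₂ →
            Disjoint (closure ({ζ₁} : Set X₁)) (closure {ζ₂})) := by
  intro p hp X _ _ hchar hX hqe hX3 G hG J μ hμ hle hcodim hRT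
  haveI := hchar
  exact exists_isCleanPermissibleSeq_tidy_of_noBad_of_minimal hp hX hqe hX3 G hG J hμ hle hcodim hRT
    (fun hch hY hYqe hY3 GY hGY JY hleY hcodY hRTY hmeet hmin =>
      hphaseTwoMin p hp hch hY hYqe hY3 GY hGY JY hμ hleY hcodY hRTY hmeet hmin)

/-! ## §3 TWELFTH CUT: X44c ⟸ (R1ᵐⁱⁿ) ∧ (R3ᵛⁿ′) -/

set_option maxHeartbeats 1600000 in
-- long binder lists
/-- **THE CLEAN ASSEMBLY, TWELFTH CUT: X44c (`stub_cleanProp44`, verbatim) ⟸ (R1ᵐⁱⁿ) clean Phase II of reach-tidy AT ITS `Λ`-MINIMAL STAGES ∧ (R3ᵛⁿ′)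
the clean curve slice for curves through a `τ = 1` point that need an insertion or carry a very near point** — the hypothesis `hcurveTauOneVN` of
✓ `cleanProp44_of_phaseTwo_of_curveTauOneVN` VERBATIM, its hypothesis `hphaseTwo` NARROWED to `hphaseTwoMin` by `phaseTwo_of_phaseTwoMin`.  The eleventh
cut ✓ `cleanProp44_of_phaseTwoNCP_of_curveTauOneVN` is this one composed with `phaseTwoMin_of_phaseTwoNCP` (companion file).
[cite: CossartPiltant2008, Prop. 4.2 (b), Prop. 4.4 (proof, p. 10, step 3), Lemma 4.5] [cite: CossartJannsenSaito2020, Thm. 13.7]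
[cite: Piltant2013, §2 Axiom 4, Prop. 5.1 (proof, Step 2)] -/
theorem cleanProp44_of_phaseTwoMin_of_curveTauOneVN
    (hphaseTwoMin : ∀ (p : ℕ), p.Prime → ∀ {X : Scheme.{0}} [IsIntegral X] [IsNoetherian X], CharP X.functionField p →
      ∀ (hX : Scheme.IsRegular X), Scheme.IsQuasiExcellent X → topologicalKrullDim X ≤ 3 →
      ∀ (G : X.functionField), (∀ x : X, CleanRegAt p (algebraMap (X.presheaf.stalk x) X.functionField) G) →
      ∀ (J : X.IdealSheafData) {μ : ℕ}, 1 ≤ μ → (∀ z, idealOrder J z ≤ μ) → (∀ z ∈ J.support, 1 < Order.coheight z) →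
      (∀ x : X, ¬ ∃ C ∈ {C : Closeds X | ∃ ζ ∈ maxPoints {z : X | (μ : ℕ∞) ≤ idealOrder J z},
          ¬ IsClosed ({ζ} : Set X) ∧ C = ⟨closure {ζ}, isClosed_closure⟩},
        x ∈ (vanishingIdeal C).subschemeι '' (Scheme.regularLocus (vanishingIdeal C).subscheme)ᶜ ∨
        (x ∈ (C : Set X) ∧ ∃ C' ∈ {C : Closeds X | ∃ ζ ∈ maxPoints {z : X | (μ : ℕ∞) ≤ idealOrder J z},
            ¬ IsClosed ({ζ} : Set X) ∧ C = ⟨closure {ζ}, isClosed_closure⟩}, C' ≠ C ∧ x ∈ (C' : Set X) ∧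
          stalkIdeal (vanishingIdeal C) x ⊔ stalkIdeal (vanishingIdeal C') x ≠ maximalIdeal (X.presheaf.stalk x))) →
      -- (meet) two distinct curves of `Σ` meet
      (∃ ζ₁ ζ₂ : X, (μ : ℕ∞) ≤ idealOrder J ζ₁ ∧ Order.coheight ζ₁ = 2 ∧ ¬ IsClosed ({ζ₁} : Set X) ∧
          (μ : ℕ∞) ≤ idealOrder J ζ₂ ∧ Order.coheight ζ₂ = 2 ∧ ¬ IsClosed ({ζ₂} : Set X) ∧ ζ₁ ≠ ζ₂ ∧
          ¬ Disjoint (closure ({ζ₁} : Set X)) (closure {ζ₂})) →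
      -- (min) `Λ` does not drop along any clean-permissible sequence reaching a stage without bad points
      (∀ (X₁ : Scheme.{0}) [IsIntegral X₁] (Φ : X₁ ⟶ X) [IsDominant Φ] (J₁ : X₁.IdealSheafData),
        IsCleanPermissibleSeq p Φ J μ J₁ G →
        (∀ x : X₁, ¬ ∃ C ∈ {C : Closeds X₁ | ∃ ζ ∈ maxPoints {z : X₁ | (μ : ℕ∞) ≤ idealOrder J₁ z},
            ¬ IsClosed ({ζ} : Set X₁) ∧ C = ⟨closure {ζ}, isClosed_closure⟩},
          x ∈ (vanishingIdeal C).subschemeι '' (Scheme.regularLocus (vanishingIdeal C).subscheme)ᶜ ∨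
          (x ∈ (C : Set X₁) ∧ ∃ C' ∈ {C : Closeds X₁ | ∃ ζ ∈ maxPoints {z : X₁ | (μ : ℕ∞) ≤ idealOrder J₁ z},
              ¬ IsClosed ({ζ} : Set X₁) ∧ C = ⟨closure {ζ}, isClosed_closure⟩}, C' ≠ C ∧ x ∈ (C' : Set X₁) ∧
            stalkIdeal (vanishingIdeal C) x ⊔ stalkIdeal (vanishingIdeal C') x ≠ maximalIdeal (X₁.presheaf.stalk x))) →
        (∑ᶠ ζ ∈ {ζ : X | ζ ∈ maxPoints {z : X | (μ : ℕ∞) ≤ idealOrder J z} ∧ ¬ IsClosed ({ζ} : Set X)},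
            (Module.length (X.presheaf.stalk ζ) (X.presheaf.stalk ζ ⧸ stalkIdeal J ζ)).toNat) ≤
          (∑ᶠ ζ ∈ {ζ : X₁ | ζ ∈ maxPoints {z : X₁ | (μ : ℕ∞) ≤ idealOrder J₁ z} ∧ ¬ IsClosed ({ζ} : Set X₁)},
              (Module.length (X₁.presheaf.stalk ζ) (X₁.presheaf.stalk ζ ⧸ stalkIdeal J₁ ζ)).toNat)) →
      ∃ (X₁ : Scheme.{0}) (Φ : X₁ ⟶ X) (_ : IsIntegral X₁) (_ : IsDominant Φ) (J₁ : X₁.IdealSheafData)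
        (_ : IsCleanPermissibleSeq p Φ J μ J₁ G),
        (∀ ζ : X₁, (μ : ℕ∞) ≤ idealOrder J₁ ζ → Order.coheight ζ = 2 → ¬ IsClosed ({ζ} : Set X₁) →
            Scheme.IsRegular (vanishingIdeal (⟨closure {ζ}, isClosed_closure⟩ : Closeds X₁)).subscheme) ∧
        (∀ ζ₁ ζ₂ : X₁, (μ : ℕ∞) ≤ idealOrder J₁ ζ₁ → Order.coheight ζ₁ = 2 → ¬ IsClosed ({ζ₁} : Set X₁) →
            (μ : ℕ∞) ≤ idealOrder J₁ ζ₂ → Order.coheight ζ₂ = 2 → ¬ IsClosed ({ζ₂} : Set X₁) → ζ₁ ≠ ζ₂ →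
            Disjoint (closure ({ζ₁} : Set X₁)) (closure {ζ₂})))
    (hcurveTauOneVN : ∀ (p : ℕ), p.Prime → ∀ {X : Scheme.{0}} [IsIntegral X] [IsNoetherian X], CharP X.functionField p →
      ∀ (hX : Scheme.IsRegular X), Scheme.IsQuasiExcellent X → topologicalKrullDim X ≤ 3 →
      ∀ (G : X.functionField), (∀ x : X, CleanRegAt p (algebraMap (X.presheaf.stalk x) X.functionField) G) →
      ∀ (J : X.IdealSheafData) {m : ℕ}, 1 ≤ m → (∀ z, idealOrder J z ≤ m) → (∀ z ∈ J.support, 1 < Order.coheight z) →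
      ∀ (V : X.Opens) (Y : Closeds X), Scheme.IsRegular (vanishingIdeal Y).subscheme → IsIrreducible (Y : Set X) →
      (Y : Set X) ⊆ (V : Set X) → (∀ z : X, (m : ℕ∞) ≤ idealOrder J z → z ∈ (Y : Set X) ∨ z ∉ (V : Set X)) →
      (∀ y ∈ (Y : Set X), idealOrder J y = m) →
      (∀ y ∈ (Y : Set X), haveI := hX y; ∃ c : Fin 2 → X.presheaf.stalk y, IsRsopPart c ∧
        Ideal.span (Set.range c) = stalkIdeal (vanishingIdeal Y) y) →
      (¬ ∀ y ∈ (Y : Set X), IsClosed ({y} : Set X) → haveI := hX y; 2 ≤ stalkTau J y m) →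
      -- (VN′) NOT (clean-permissible at every point of `Y` AND no very near point over `Y` for the blowing ups of `X` along `Y`)
      (¬ ((∀ y ∈ (Y : Set X), CleanPermissibleAt p (algebraMap (X.presheaf.stalk y) X.functionField) G (stalkIdeal (vanishingIdeal Y) y)) ∧
          (∀ (X₁ : Scheme.{0}) (π : X₁ ⟶ X), IsBlowup π (vanishingIdeal Y) →
            ∀ x' : X₁, IsClosed ({x'} : Set X₁) → π x' ∈ (Y : Set X) →
              idealOrder (controlledTransform π (vanishingIdeal Y) J m) x' = m →
              (maximalIdeal (X₁.presheaf.stalk x')).spanFinrank = 3 →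
              ∀ hr : IsRegularLocalRing (X₁.presheaf.stalk x'), 2 ≤ @stalkTau X₁ (controlledTransform π (vanishingIdeal Y) J m) x' hr m))) →
      ∀ [IsIntegral ((V : X.Opens) : Scheme.{0})] [IsDominant V.ι],
      ∃ (V' : Scheme.{0}) (π : V' ⟶ V) (_ : IsIntegral V') (_ : IsDominant π) (K' : V'.IdealSheafData),
        IsCleanPermissibleSeq p π (J.comap V.ι) m K' (RatFn.functionFieldMap V.ι G) ∧ ∀ y, idealOrder K' y < m) :
    ∀ (p : ℕ), p.Prime → ∀ (S : Scheme.{0}) [IsIntegral S] [IsNoetherian S],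
      CharP S.functionField p → Scheme.IsRegular S → Scheme.IsExcellent S → topologicalKrullDim S = 3 →
      ∀ G₀ : S.functionField, (∀ s : S, CleanRegAt p (algebraMap (S.presheaf.stalk s) S.functionField) G₀) →
      ∀ I : S.IdealSheafData, I ≠ ⊥ →
      ∀ (X : Scheme.{0}) (ρ : X ⟶ S) [IsIntegral X] [IsNoetherian X] [IsDominant ρ],
        IsCleanRegularCentreBlowupSeq p ρ I G₀ →
        (∀ x : X, CleanRegAt p (algebraMap (X.presheaf.stalk x) X.functionField) (RatFn.functionFieldMap ρ G₀)) →
        ∀ (J : X.IdealSheafData) (μ : ℕ), 1 ≤ μ →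
          (∀ x ∈ J.support, 1 < Order.coheight x) → (∀ x, idealOrder J x ≤ μ) → (∃ x, idealOrder J x = μ) →
          ∃ (X' : Scheme.{0}) (π : X' ⟶ X) (_ : IsIntegral X') (_ : IsDominant π) (J' : X'.IdealSheafData),
            IsCleanPermissibleSeq p π J μ J' (RatFn.functionFieldMap ρ G₀) ∧ ∀ x, idealOrder J' x < μ :=
  cleanProp44_of_phaseTwo_of_curveTauOneVN (phaseTwo_of_phaseTwoMin hphaseTwoMin) hcurveTauOneVN

end Summit.ResolutionOfSingularities.ResolutionOfSingularities.Theorems.RadicialJung.CleanModels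

end
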